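import Summits.QuantumFields.YangMills.Theorems.FluctuationComparisonRegPrIntLS2BetaRestr129OfParallelSplit
import Summits.QuantumFields.YangMills.Theorems.FluctuationComparisonRegPrIntLS2BetaSigmaRepSplit
import Summits.QuantumFields.YangMills.Theorems.FluctuationComparisonRegPrIntLS2BetaOrbitGrowthOfRegular
import Summits.QuantumFields.YangMills.Theorems.FluctuationComparisonRegPrIntLS2BetaCriticalELRelated
import Summits.QuantumFields.YangMills.Theorems.FluctuationComparisonRegPrIntLS2BetaGapFlatOfStabiliserLift
import Summits.QuantumFields.YangMills.Theorems.UnitScaleTiltProp7OrbitTransport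
import Summits.QuantumFields.YangMills.Theorems.AlphaInputsT3ACv3StepLowPrintOrbitOfThm1Unique
import Summits.QuantumFields.YangMills.Theorems.UnitScaleTiltThm1GuardedFiveResidueThree
import HarnessLib

/-!
# S2β · ★★★★★ THE DATUM's SYMMETRIES LIFT TO EVERY R2-CRITICAL REGULAR POINT (`hlift`), AT EVERY DATUM, `L ≥ 5`, WITH NO LETTER — hence [Balaban1985Variational] PROP. 7
# CLAUSE 1 AT EVERY DATUM and GAP♭ AT EVERY DATUM (✓px17 pen 7 and FILE 1 with their one row discharged)

Cell `ym3-torus` (YM ladder rung R3 = continuum `SU(2)` Yang–Mills on the three-torus at fixed lattice data — a RUNG: NOT d = 4, NOT infinite volume, NOT a mass gap,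
NOT Clay).  Width seat `ym3-torus-px13` (gen 21), FILE B of the pen «`hlift` for free from (1.29)» (FILE A = ✓`…S2BetaRestr129OfParallelSplit`); crux `stmt-QuantumFields-20520`
(`…Theses.UnitScaleTilt.FluctuationComparisonRegPrIntL`), LINE g18-1 S2β, organ GAP♯∘ ∕ the per-datum GAP♭ board (UV3-NODE §37–§40, §44; px17 g16 FILE 1∕3, px12 g21 (B),
px8 g19 (T7-red), px16 g18 (D1)–(D6), px21 g19 (T7)); `--kind proof --supports stmt-QuantumFields-20520 --as helper`, count-neutral, DEFINITION-FREE (0 `def`, 0 `instance`,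
0 `notation`, 0 `sorry`, default heartbeats).

WHY.  After ✓px17 pen 7 (`atMostOneCriticalOrbit_of_el_symmetriesLift_five`: Prop. 7 cl. 1 over `V` ⟸ ONE E–L-critical regular `W` whose datum-symmetries lift) and ✓px17
FILE 1 (`gapFlat_at_min_of_lift_five`: GAP♭(V,U₀) ⟸ the same `hlift` row at the minimiser `U₀`), the per-datum board's ONLY remaining letter at a general (reducible) datum was
`hlift` — supplied so far per stratum: irreducible data (✓px17 pen 6 `centralStab_of_irr`), central-holonomy data (✓px12 FILE 4 ∕ ✓px16 (D4)–(D6)), and the abelian case A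
modulo the analytic letter REG^{ab} (✓px12 FILE 7, ✓px17 `…GapFlatOfRegAb`) or NSR + lift (px8).  THIS FILE proves `hlift` at EVERY R2-critical regular point over EVERY datum
from the tree's own gauge-fixing kinematics, with no stratification and no analytic letter: for a symmetry `s` of `V` let `κ := liftTransfTo s` (`κ↓ = s`); `W′ := κ • W` is
again R2-critical over `V` (✓`isCritR2_gaugeAct`), so BOTH `W`, `W′` are E–L-critical (Fermat, ✓`Prop7CritEL`); brick 1 (✓`exists_sigmaRep_split_five`) represents
`v • W′ = u • (e^{iX}·W)` with `v = 1` at the `(K−n)`-centres, `u` (1.29)-restricted, `v • W′` axial relative to `W`, `A(W′) = A(e^{iX}·W)`; (142) with its rate at `W`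
(✓`sigmaGrowth_holds`) and the orbit growth at `W′` (✓`orbitGrowth_of_regular_five`) force `X = 0` (§1), i.e. `(vκ) • W = u • W`; so `k := u⁻¹vκ ∈ Stab(W)` and `u = (vκ)·k⁻¹`
with `(vκ) • W` axial and `k • W = W` — exactly FILE A's (1.29)-corner situation, whence `u↓ = 1` (✓`descTransf_eq_one_of_restrictedPrint_split`) and
`k↓ = (u↓)⁻¹·(v↓)·(κ↓) = s` (§2).  §3–§4 plug the row into pen 7 and FILE 1 BY NAME.

WHAT IS PROVED (sorry-free; every `L ≥ 5`, where the [Balaban1985RegularSpaces] Thm-2 socket is a tree theorem — ✓`hThm2S_body_of_five_le`).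
* §1 ★★★ `criticalRep_split_five` — `∃ e₈ > 0`: two E–L-critical `W, W′ ∈ regFibrePr F n K e V` (`0 < e ≤ e₈`) are related by `v • W′ = u • W` with `v (embIter (K−n) y) = 1 ∀ y`,
  `RestrictedPrint F n K W u`, `IsAxialPrint F n K W (v • W′)` (the STRUCTURED form of ✓`critical_gaugeRelated_of_el_five`).
* §2 ★★★★★ `symmetriesLift_of_isCritR2_five (L) (h5 : 5 ≤ L) : ∃ e₈ > 0, ∀ F (F.L = L) n K (hnK : n < K) e V W, 0 < e → e ≤ e₈ → W ∈ regFibrePr F n K hnK.le e V →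
  IsCritR2 F n K hnK.le V W → ∀ s, s • V = V → ∃ k, k • W = W ∧ descTransf F n K hnK.le k = s` — `hlift` AT EVERY R2-CRITICAL REGULAR POINT, EVERY DATUM.
* §3 ★★★★★ `atMostOneCriticalOrbit_five (L) (h5) : ∃ e₉ > 0, ∀ F (F.L = L) n K hnK e V, 0 < e → e ≤ e₉ → (varProblem3 F n K hnK.le).AtMostOneCriticalOrbit e V` —
  **[Balaban1985Variational] PROP. 7 CLAUSE 1 AT EVERY DATUM OF EVERY MEMBER, `L ≥ 5`, NO HYPOTHESIS ON THE DATUM** (✓pen 7 §4 witnessed by the first critical point itself).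
* §4 ★★★★★ `gapFlat_at_min_five (L) (h5) (b₀ p₀) (hb hp)` — ✓FILE 1 `gapFlat_at_min_of_lift_five`'s statement with the `hlift` row DELETED: **GAP♭(V, U₀) AT EVERY DATUM `V` AND
  EVERY MINIMISER `U₀ ∈ regFibrePr ε₀ V`, `A(U₀) = minActionRegPr ε₀ V` (`0 < ε₀ ≤ e₉(L)`), per-base-point `γ ≤ γs`** (FILE 1's `γs`, `μ` verbatim).

* §5 ★★★★★ `prop7AtMostOneCriticalOrbitAt_five (L) (h5) (B₃ > 0) : ∃ a₀ > 0, Prop7AtMostOneCriticalOrbitAt L a₀ B₃` and ★★★★★ `thm1UniqueMinOrbitAt_five (L) (h5) (B₃ > 0) (a₁) :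
  ∃ a₀ > 0, Thm1UniqueMinOrbitAt L a₀ a₁ B₃` — THE LITERATURE SCHEMAS of [Balaban1985Variational] Prop. 7 clause 1 and Thm 1 sentence 2 (lit ✓`T3Thm1UniquenessSchema`, hitherto
  HYPOTHESES `h7`∕`hT` of ✓`…ArgminOrbitOfUniqueCriticalOrbit`, ✓`AlphaInputsT3AC.hcov_of_prop7AtMostOneCriticalOrbitAt`, ✓`…RegArgminFlat`, …) PROVED at every `L ≥ 5`.

* §6 ★★★★★ `thm1Pair_five (L) (h5) : ∃ a₀ a₁ B₃ > 0, Thm1GlobalMinAt L a₀ a₁ B₃ ∧ Thm1UniqueMinOrbitAt L a₀ a₁ B₃` — [Balaban1985Variational] THEOREM 1, BOTH SENTENCES, AT EVERY `L ≥ 5`, ZERO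
  HYPOTHESES (sentence 1 = ✓`thm1GlobalMinAt_five`); `thm1Pair_allL_of_three` — the all-`L` pair (✓`argmin_eq_orbit_of_thm1Pair_of_regArgmin`'s `hT`) from its `L = 3` instance ALONE.

WHAT THIS RETIRES FROM THE CRITICAL PATH (they stay true and importable): the `hlift`∕NSR∕(T7-red) roads, EX^{ab}′∕REG^{ab}∕NE^{ab} as letters for Prop. 7 cl. 1 (✓px12 FILEs 3–7),
the case A∕B∕irreducible stratification for GAP♭ (✓px16 (D2)–(D6), ✓px21 (T7e), ✓px17 `…GapFlatOfRegAb`).  WHAT IT DOES NOT TOUCH: TUBE-REG∘'s UNIFORM order (datum-free `δ`,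
`K`-uniform `μ`, uniform `γ₁` — RECORD 17gh ∕ UV3-NODE §40.3), GAP♯∘ AS REGISTERED (uniform prefix; consumed per datum by the registry's two consumers, px17 g14 CERTs), EXW∘,
the `L = 3` socket (EMBARGO-LITE №58), S2β's other four stubs.

HONEST.  Composition BY NAME of landed theorems + FILE A's kinematic identity; nothing of Bałaban's ANALYSIS is added ((142)'s rate, the Thm-2 socket and the Σ-representation
are the tree's); TUBE-REG∘ (uniform), GAP♯∘ as registered, EXW∘, S2β, the five registered ∘-stubs, crux 20520, 19936, 19200 and `YM3TorusSU2` are NOT proved; no summit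
statement is proved by a helper; rung R3 = SU(2) YM₃ on T³ at fixed lattice data — NOT d = 4, NOT infinite volume, NOT a mass gap, NOT Clay; the Yang–Mills mass gap is NOT
proved.  Axioms standard.

References: T. Bałaban, CMP **102** (1985) 277–309 [Balaban1985Variational] ((4)–(6) p.278, (18)–(21) pp.280–281, Prop. 2 p.281, (141)–(143) p.299, Prop. 7 p.299);
CMP **99** (1985) 75–102 [Balaban1985RegularSpaces] ((1.14) p.78, (1.19) p.79, (1.29) p.81, Thm 2 p.83); CMP **98** (1985) 17–51 [Balaban1985Averaging] ((8)–(13) p.19,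
(78)–(81) p.30); CMP **99** (1985) 389–434 [Balaban1985BackgroundPropagators] (Thm 3.11 p.416).
-/

set_option autoImplicit false

noncomputable section

namespace Summit.QuantumFields.YangMills.Theorems.FluctuationComparisonRegPrIntLS2BetaSymmetriesLiftOfCritical

open scoped BigOperators Matrix.Norms.L2Operator Matrix

open Literature.MathematicalPhysics.QuantumFieldTheory.Balaban1983to89
open Literature.MathematicalPhysics.QuantumFieldTheory.Balaban1983to89.T3ContinuumYM3Torus
open Literature.MathematicalPhysics.QuantumFieldTheory.Balaban1983to89.T3UnitLawDensityEML (ℰp)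
open Literature.MathematicalPhysics.QuantumFieldTheory.Balaban1983to89.T3TiltDescent (descendTo)
open Literature.MathematicalPhysics.QuantumFieldTheory.Balaban1983to89.T3ConstrainedMinimiser (fibre)
open Literature.MathematicalPhysics.QuantumFieldTheory.Balaban1983to89.T3PrintedRegularMinimiser (RegPr regFibrePr mem_regFibrePr_iff)
open Literature.MathematicalPhysics.QuantumFieldTheory.Balaban1983to89.T3PrintedRegularOrbits (descTransf liftTransfTo descTransf_liftTransfTo
  gaugeAct_mem_regFibrePr_iff)
open Literature.MathematicalPhysics.QuantumFieldTheory.Balaban1983to89.T3Thm1Carrier (SameOrbit varProblem3)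
open Literature.MathematicalPhysics.QuantumFieldTheory.Balaban1983to89.T3Thm1CarrierNative (IsCritR2)
open Literature.MathematicalPhysics.QuantumFieldTheory.Balaban1983to89.T3SectALandauChart (emb15 eta In19 descTransf_mul descTransf_inv)
open Literature.MathematicalPhysics.QuantumFieldTheory.Balaban1983to89.T3UnitLawGaugeInvariance (gaugeAct_gaugeAct)
open T4Continuum
open B7Prop2Explicit (C0 c2' C0_pos c2'_pos)
open B15DeterminingSets (embIter)
open Summit.QuantumFields.YangMills.Theorems.Prop7TPrint (expHermField expHermField_apply expHerm_zero)
open Summit.QuantumFields.YangMills.Theorems.Prop7SPrint (IsAxialPrint RestrictedPrint)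
open Summit.QuantumFields.YangMills.Theorems.Prop7TwistRegauge (descTransf_mul_inv_eq_one)
open Summit.QuantumFields.YangMills.Theorems.Prop7CritEL (deriv_comp_eq_zero_of_isCritR2 continuousAt_of_differentiableAt_bonds)
open Summit.QuantumFields.YangMills.Theorems.Prop7OrbitTransport (isCritR2_gaugeAct)
open Summit.QuantumFields.YangMills.Theorems.FluctuationComparisonRegPrIntLS2BetaSigmaRepSplit (exists_sigmaRep_split_five)
open Summit.QuantumFields.YangMills.Theorems.FluctuationComparisonRegPrIntLS2BetaSigmaGrowthRate (sigmaGrowth_holds)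
open Summit.QuantumFields.YangMills.Theorems.FluctuationComparisonRegPrIntLS2BetaOrbitGrowthOfRegular (orbitGrowth_of_regular_five)
open Summit.QuantumFields.YangMills.Theorems.FluctuationComparisonRegPrIntLS2BetaCriticalELRelated (atMostOneCriticalOrbit_of_el_symmetriesLift_five)
open Summit.QuantumFields.YangMills.Theorems.FluctuationComparisonRegPrIntLS2BetaRestr129OfParallelSplit (descTransf_eq_one_of_restrictedPrint_split)
open Summit.QuantumFields.YangMills.Theorems.FluctuationComparisonRegPrIntLS2BetaGapFlatOfStabiliserLift (gapFlat_at_min_of_lift_five posCollar_at_isCritR2_of_lift_five')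
open Literature.MathematicalPhysics.QuantumFieldTheory.Balaban1983to89.T3Thm1CarrierNative (isCritR2_of_isMinOn)
open Literature.MathematicalPhysics.QuantumFieldTheory.Balaban1983to89.T3UnitScaleTilt (histGood θBal)
open Literature.MathematicalPhysics.QuantumFieldTheory.Balaban1983to89.T3PrintedRegularMinimiser (minActionRegPr minActionRegPr_le)
open Set
open Literature.MathematicalPhysics.QuantumFieldTheory.Balaban1983to89.T3Thm1UniquenessSchema (Thm1UniqueMinOrbitAt Prop7AtMostOneCriticalOrbitAt)
open Summit.QuantumFields.YangMills.Theorems.AlphaInputsT3AC (thm1UniqueMinOrbitAt_of_prop7 thm1UniqueMinOrbitAt_mono)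
open Literature.MathematicalPhysics.QuantumFieldTheory.Balaban1983to89.T3PrintedMinimiserExistence (Thm1GlobalMinAt)
open Summit.QuantumFields.YangMills.Theorems.Thm1GuardedFiveResidueThree (thm1GlobalMinAt_five five_le_of_odd_of_ne_three)

/-! ## §1 Two E–L-critical regular points over one datum: the STRUCTURED gauge relation `v • W′ = u • W` (`v↓ = 1`, `u` (1.29)-restricted, `v • W′` axial) -/

/-- ★★★ **TWO E–L-CRITICAL REGULAR POINTS OVER ONE DATUM: THE STRUCTURED GAUGE RELATION `v • W′ = u • W`** (`L ≥ 5`, `0 < e ≤ e₈(L)`): for E–L-critical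
`W, W′ ∈ regFibrePr F n K e V` there are gauge transformations `v` (`= 1` at every `(K−n)`-centre) and `u` ((1.29)-restricted relative to `W`, `RestrictedPrint F n K W u`) with
`v • W′` in the iterated axial gauge (1.19) relative to `W` (`IsAxialPrint F n K W (v • W′)`) and `v • W′ = u • W`.  Brick 1 (✓`exists_sigmaRep_split_five`) gives
`v • W′ = u • (e^{iX}·W)`, `A(W′) = A(e^{iX}·W)`; (142) with its rate at `W` (✓`sigmaGrowth_holds`) and the orbit growth at `W′` over the competitor `W`
(✓`orbitGrowth_of_regular_five`) give `c·ℓ⁻²·Σ‖X_b‖² ≤ A(W′) − A(W) ≤ 0`, so `X = 0`.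
[cite: Balaban1985Variational, (141)-(143) p.299, Prop. 2 p.281, (18)-(21) pp.280-281; Balaban1985RegularSpaces, Thm 2 p.83, (1.29) p.81, (1.19) p.79] -/
theorem criticalRep_split_five (L : ℕ) (h5 : 5 ≤ L) :
    ∃ e₈ : ℝ, 0 < e₈ ∧
      ∀ (F : T3Family), F.L = L → ∀ (n K : ℕ) (hnK : n < K) (e : ℝ) (V : GaugeField (F.P n) 0 (Matrix.specialUnitaryGroup (Fin 2) ℂ))
        (W W' : GaugeField (F.P K) 0 (Matrix.specialUnitaryGroup (Fin 2) ℂ)),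
        0 < e → e ≤ e₈ → W ∈ regFibrePr F n K hnK.le e V →
        (∀ γ : ℝ → GaugeField (F.P K) 0 (Matrix.specialUnitaryGroup (Fin 2) ℂ), γ 0 = W → (∀ t, γ t ∈ fibre F ℰp n K hnK.le V) →
          (∀ b, DifferentiableAt ℝ (fun t => ((γ t b : Matrix.specialUnitaryGroup (Fin 2) ℂ) : Matrix (Fin 2) (Fin 2) ℂ)) 0) →
            deriv (fun t => wilsonAction4 (γ t)) 0 = 0) →
        W' ∈ regFibrePr F n K hnK.le e V →
        (∀ γ : ℝ → GaugeField (F.P K) 0 (Matrix.specialUnitaryGroup (Fin 2) ℂ), γ 0 = W' → (∀ t, γ t ∈ fibre F ℰp n K hnK.le V) →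
          (∀ b, DifferentiableAt ℝ (fun t => ((γ t b : Matrix.specialUnitaryGroup (Fin 2) ℂ) : Matrix (Fin 2) (Fin 2) ℂ)) 0) →
            deriv (fun t => wilsonAction4 (γ t)) 0 = 0) →
          ∃ (v u : GaugeTransf (F.P K) 0 (Matrix.specialUnitaryGroup (Fin 2) ℂ)),
            (∀ y : Site (F.P K) (K - n), v (embIter (K - n) y) = 1) ∧
            RestrictedPrint F n K W u ∧ IsAxialPrint F n K W (GaugeField.gaugeAct v W') ∧
            GaugeField.gaugeAct v W' = GaugeField.gaugeAct u W := by
  have hL : 1 < L := by omega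
  obtain ⟨B₁', c₁', hB₁', hc₁', HREP⟩ := exists_sigmaRep_split_five L h5
  obtain ⟨e₇, c, he₇, hc, HGROW⟩ := sigmaGrowth_holds L hL B₁' hB₁'
  obtain ⟨e₈, c', he₈, hc', HORB⟩ := orbitGrowth_of_regular_five L h5
  have hC0 : 0 < C0 3 := C0_pos 3
  have hc2 : 0 < c2' 3 L := c2'_pos 3 L (by omega)
  refine ⟨min e₈ (min e₇ (min (c₁' / 2) (min (1 / (6 * C0 3)) (c2' 3 L / 4)))),
    lt_min he₈ (lt_min he₇ (lt_min (by positivity) (lt_min (by positivity) (by positivity)))), ?_⟩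
  intro F hF n K hnK e V W W' he hee hW hELW hW' hELW'
  have he₈' : e ≤ e₈ := hee.trans (min_le_left _ _)
  have he₇' : e ≤ e₇ := (hee.trans (min_le_right _ _)).trans (min_le_left _ _)
  have h3 := (hee.trans (min_le_right _ _)).trans (min_le_right _ _)
  have h2e : 2 * e ≤ c₁' := by have := h3.trans (min_le_left _ _); linarith
  have hα3 : C0 3 * (2 * e) ≤ 1 / 3 := by
    have h1 : e ≤ 1 / (6 * C0 3) := (h3.trans (min_le_right _ _)).trans (min_le_left _ _)
    rw [le_div_iff₀ (by positivity)] at h1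
    linarith
  have hα2 : 2 * (2 * e) ≤ c2' 3 L := by
    have h1 : e ≤ c2' 3 L / 4 := (h3.trans (min_le_right _ _)).trans (min_le_right _ _)
    linarith
  -- brick 1: the Σ-representation of `W′` at background `W`, gauge split kept
  obtain ⟨v, u, X, hv1, -, hrestr, hax, -, hvW', h19, h20, h21, hA⟩ := HREP F hF n K hnK e V W he h2e hα3 hα2 hW W' hW'
  -- (142) at `W` for this `X`, and the growth at `W′` with competitor `W`: equal actions, `X = 0`
  have hgrow := HGROW F hF n K hnK e V W X he he₇' hW hELW h19 h20 h21
  obtain ⟨u₀, hu₀⟩ := HORB F hF n K hnK e V W' he he₈' hW' hELW' W hW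
  have hℓ : (0 : ℝ) < ((F.L : ℝ) ^ (K - n)) ^ 2 := by
    have hL0 : (0 : ℝ) < (F.L : ℝ) := by have := F.hL.2; exact_mod_cast (by omega : 0 < F.L)
    positivity
  have hS0 : 0 ≤ ∑ ℓ : PBond (F.P K) 0, dist1 (W ℓ * ((GaugeField.gaugeAct u₀ W') ℓ)⁻¹) ^ 2 := Finset.sum_nonneg fun _ _ => sq_nonneg _
  have hle : wilsonAction4 W' - wilsonAction4 W ≤ 0 := by
    have := (mul_nonneg (mul_nonneg hc'.le (inv_nonneg.mpr hℓ.le)) hS0).trans hu₀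
    linarith
  have hX0 : ∑ b : PBond (F.P K) 0, ‖X b‖ ^ 2 = 0 := by
    have h1 : c * (((F.L : ℝ) ^ (K - n)) ^ 2)⁻¹ * ∑ b : PBond (F.P K) 0, ‖X b‖ ^ 2 ≤ 0 := by rw [hA] at hle; exact hgrow.trans hle
    have hpos : 0 < c * (((F.L : ℝ) ^ (K - n)) ^ 2)⁻¹ := mul_pos hc (inv_pos.mpr hℓ)
    have hS : 0 ≤ ∑ b : PBond (F.P K) 0, ‖X b‖ ^ 2 := Finset.sum_nonneg fun _ _ => sq_nonneg _
    nlinarith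
  have hXb : ∀ b : PBond (F.P K) 0, X b = 0 := by
    intro b
    have h1 := (Finset.sum_eq_zero_iff_of_nonneg fun b _ => sq_nonneg (‖X b‖)).1 hX0 b (Finset.mem_univ b)
    exact norm_eq_zero.1 (pow_eq_zero_iff (n := 2) (by norm_num) |>.1 h1)
  have hemb : emb15 W (expHermField X) = W := by
    funext b
    show expHermField X b * W b = W b
    rw [expHermField_apply, hXb b, expHerm_zero, one_mul]
  refine ⟨v, u, hv1, hrestr, hax, ?_⟩
  rw [hvW', hemb]

/-! ## §2 ★★★★★ THE DATUM's SYMMETRIES LIFT TO EVERY R2-CRITICAL REGULAR POINT — every datum, `L ≥ 5`, NO letter -/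

/-- ★★★★★ **THE DATUM's SYMMETRIES LIFT TO EVERY R2-CRITICAL REGULAR POINT — EVERY DATUM, `L ≥ 5`, NO LETTER** (`hlift`, the row of ✓px17 pen 7 ∕ FILE 1, ✓px8 (T7-red),
✓px12 FILE 3): `∃ e₈ > 0` such that at every member, heights `n < K`, `0 < e ≤ e₈`, datum `V`, every `W ∈ regFibrePr F n K e V` minimising the action over some regular fibre
of `V` (`IsCritR2`), and every coarse gauge transformation `s` with `s • V = V`, there is a fine `k` with `k • W = W` and `k↓ = s`.  Proof: `κ := liftTransfTo s`;
`W′ := κ • W` is R2-critical over `V` (✓`isCritR2_gaugeAct`); both are E–L-critical (✓`deriv_comp_eq_zero_of_isCritR2`); §1 gives `v • W′ = u • W`; `k := u⁻¹·v·κ`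
fixes `W`; `u = (vκ)·k⁻¹` with `(vκ) • W` axial and `k ∈ Stab(W)`, so `u↓ = 1` by FILE A (✓`descTransf_eq_one_of_restrictedPrint_split`), `v↓ = 1`, `κ↓ = s`.
[cite: Balaban1985Variational, (4)-(6) p.278, Prop. 7 p.299, Prop. 2 p.281; Balaban1985RegularSpaces, (1.29) p.81, (1.19) p.79, (1.14) p.78; Balaban1985Averaging, (11)-(13) p.19, (78)-(81) p.30] -/
theorem symmetriesLift_of_isCritR2_five (L : ℕ) (h5 : 5 ≤ L) :
    ∃ e₈ : ℝ, 0 < e₈ ∧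
      ∀ (F : T3Family), F.L = L → ∀ (n K : ℕ) (hnK : n < K) (e : ℝ) (V : GaugeField (F.P n) 0 (Matrix.specialUnitaryGroup (Fin 2) ℂ))
        (W : GaugeField (F.P K) 0 (Matrix.specialUnitaryGroup (Fin 2) ℂ)),
        0 < e → e ≤ e₈ → W ∈ regFibrePr F n K hnK.le e V → IsCritR2 F n K hnK.le V W →
        ∀ s : GaugeTransf (F.P n) 0 (Matrix.specialUnitaryGroup (Fin 2) ℂ), GaugeField.gaugeAct s V = V →
          ∃ k : GaugeTransf (F.P K) 0 (Matrix.specialUnitaryGroup (Fin 2) ℂ), GaugeField.gaugeAct k W = W ∧ descTransf F n K hnK.le k = s := by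
  obtain ⟨e₈, he₈, H⟩ := criticalRep_split_five L h5
  refine ⟨e₈, he₈, ?_⟩
  intro F hF n K hnK e V W he hee hW hcrit s hs
  -- the lift `κ` of `s` and the moved critical point `W′ := κ • W` over the same datum
  set κ : GaugeTransf (F.P K) 0 (Matrix.specialUnitaryGroup (Fin 2) ℂ) := liftTransfTo F n K hnK.le s with hκdef
  have hκ : descTransf F n K hnK.le κ = s := descTransf_liftTransfTo F n K hnK.le s
  have hW' : GaugeField.gaugeAct κ W ∈ regFibrePr F n K hnK.le e V := by
    have h1 := (gaugeAct_mem_regFibrePr_iff F hnK.le he.le κ W V).2 hW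
    rwa [hκ, hs] at h1
  have hcrit' : IsCritR2 F n K hnK.le V (GaugeField.gaugeAct κ W) := by
    have h1 := isCritR2_gaugeAct F hnK.le κ hcrit
    rwa [hκ, hs] at h1
  have hELW : ∀ γ : ℝ → GaugeField (F.P K) 0 (Matrix.specialUnitaryGroup (Fin 2) ℂ), γ 0 = W → (∀ t, γ t ∈ fibre F ℰp n K hnK.le V) →
      (∀ b, DifferentiableAt ℝ (fun t => ((γ t b : Matrix.specialUnitaryGroup (Fin 2) ℂ) : Matrix (Fin 2) (Fin 2) ℂ)) 0) →
        deriv (fun t => wilsonAction4 (γ t)) 0 = 0 :=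
    fun γ hγ0 hγfib hγd => deriv_comp_eq_zero_of_isCritR2 hcrit γ hγ0 hγfib (continuousAt_of_differentiableAt_bonds γ hγd)
  have hELW' : ∀ γ : ℝ → GaugeField (F.P K) 0 (Matrix.specialUnitaryGroup (Fin 2) ℂ), γ 0 = GaugeField.gaugeAct κ W →
      (∀ t, γ t ∈ fibre F ℰp n K hnK.le V) →
      (∀ b, DifferentiableAt ℝ (fun t => ((γ t b : Matrix.specialUnitaryGroup (Fin 2) ℂ) : Matrix (Fin 2) (Fin 2) ℂ)) 0) →
        deriv (fun t => wilsonAction4 (γ t)) 0 = 0 :=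
    fun γ hγ0 hγfib hγd => deriv_comp_eq_zero_of_isCritR2 hcrit' γ hγ0 hγfib (continuousAt_of_differentiableAt_bonds γ hγd)
  obtain ⟨v, u, hv1, hrestr, hax, hvu⟩ := H F hF n K hnK e V W (GaugeField.gaugeAct κ W) he hee hW hELW hW' hELW'
  -- the stabiliser `k := u⁻¹·v·κ` of `W`, and `u = (v·κ)·k⁻¹`
  refine ⟨fun x => (u x)⁻¹ * (v x * κ x), ?_, ?_⟩
  · rw [← gaugeAct_gaugeAct, ← gaugeAct_gaugeAct, hvu, gaugeAct_gaugeAct]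
    have : (fun x => (u x)⁻¹ * u x) = fun _ => (1 : Matrix.specialUnitaryGroup (Fin 2) ℂ) := funext fun x => inv_mul_cancel _
    rw [this]
    funext b; simp [GaugeField.gaugeAct]
  · -- `u↓ = 1` by the (1.29)-corner identity (FILE A), `v↓ = 1`, `κ↓ = s`
    have hk : GaugeField.gaugeAct (fun x => (u x)⁻¹ * (v x * κ x)) W = W := by
      rw [← gaugeAct_gaugeAct, ← gaugeAct_gaugeAct, hvu, gaugeAct_gaugeAct]
      have : (fun x => (u x)⁻¹ * u x) = fun _ => (1 : Matrix.specialUnitaryGroup (Fin 2) ℂ) := funext fun x => inv_mul_cancel _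
      rw [this]
      funext b; simp [GaugeField.gaugeAct]
    have hax' : IsAxialPrint F n K W (GaugeField.gaugeAct (fun x => v x * κ x) W) := by rw [← gaugeAct_gaugeAct]; exact hax
    have hu1 : descTransf F n K hnK.le u = fun _ => 1 :=
      descTransf_eq_one_of_restrictedPrint_split F hnK.le (p := fun x => v x * κ x) (k := fun x => (u x)⁻¹ * (v x * κ x))
        hrestr hax' hk (fun x => by group)
    have hv : descTransf F n K hnK.le v = fun _ => 1 := by
      have h1 := descTransf_mul_inv_eq_one F hnK.le (g := v) (u := fun _ => (1 : Matrix.specialUnitaryGroup (Fin 2) ℂ)) (fun y => by rw [hv1 y])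
      simpa using h1
    rw [descTransf_mul, descTransf_mul, descTransf_inv, hu1, hv, hκ]
    funext y; simp

/-! ## §3 ★★★★★ [Balaban1985Variational] PROP. 7 CLAUSE 1 AT EVERY DATUM, `L ≥ 5` — NO letter -/

/-- ★★★★★ **[Balaban1985Variational] PROP. 7 CLAUSE 1 AT EVERY DATUM, `L ≥ 5`, NO HYPOTHESIS ON THE DATUM**: `∃ e₉ > 0` such that for every member `F` (`F.L = L`), heights
`n < K`, `0 < e ≤ e₉` and EVERY datum `V`: any two R2-critical configurations of print's regular space (6)(e) over `V` lie on one orbit of print's group (4) —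
`(varProblem3 F n K hnK.le).AtMostOneCriticalOrbit e V`.  ✓pen 7 §4 `atMostOneCriticalOrbit_of_el_symmetriesLift_five`, witnessed by the first critical point itself
(E–L by Fermat, `hlift` by §2). [cite: Balaban1985Variational, Prop. 7 p.299, Thm 1 p.279, (4)-(6) p.278, (141)-(143) p.299; Balaban1985RegularSpaces, Thm 2 p.83] -/
theorem atMostOneCriticalOrbit_five (L : ℕ) (h5 : 5 ≤ L) :
    ∃ e₉ : ℝ, 0 < e₉ ∧
      ∀ (F : T3Family), F.L = L → ∀ (n K : ℕ) (hnK : n < K) (e : ℝ) (V : GaugeField (F.P n) 0 (Matrix.specialUnitaryGroup (Fin 2) ℂ)),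
        0 < e → e ≤ e₉ → (varProblem3 F n K hnK.le).AtMostOneCriticalOrbit e V := by
  obtain ⟨e₈, he₈, H⟩ := atMostOneCriticalOrbit_of_el_symmetriesLift_five L h5
  obtain ⟨e₈', he₈', HL⟩ := symmetriesLift_of_isCritR2_five L h5
  refine ⟨min e₈ e₈', lt_min he₈ he₈', ?_⟩
  intro F hF n K hnK e V he hee U U' hUreg hUfib hUcrit hU'reg hU'fib hU'crit
  have hU : U ∈ regFibrePr F n K hnK.le e V := (mem_regFibrePr_iff F).mpr ⟨hUfib, hUreg⟩
  have hELU : ∀ γ : ℝ → GaugeField (F.P K) 0 (Matrix.specialUnitaryGroup (Fin 2) ℂ), γ 0 = U → (∀ t, γ t ∈ fibre F ℰp n K hnK.le V) →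
      (∀ b, DifferentiableAt ℝ (fun t => ((γ t b : Matrix.specialUnitaryGroup (Fin 2) ℂ) : Matrix (Fin 2) (Fin 2) ℂ)) 0) →
        deriv (fun t => wilsonAction4 (γ t)) 0 = 0 :=
    fun γ hγ0 hγfib hγd => deriv_comp_eq_zero_of_isCritR2 hUcrit γ hγ0 hγfib (continuousAt_of_differentiableAt_bonds γ hγd)
  have hlift := HL F hF n K hnK e V U he (hee.trans (min_le_right _ _)) hU hUcrit
  exact H F hF n K hnK e V he (hee.trans (min_le_left _ _)) ⟨U, hU, hELU, hlift⟩ U U' hUreg hUfib hUcrit hU'reg hU'fib hU'crit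

/-! ## §4 ★★★★★ GAP♭ AT EVERY DATUM, `L ≥ 5` — ✓px17 FILE 1 `gapFlat_at_min_of_lift_five` with its ONE row `hlift` DISCHARGED by §2 -/

/-- ★★★★★ **GAP♭ AT EVERY DATUM, `L ≥ 5`** — ✓px17 FILE 1 `gapFlat_at_min_of_lift_five` with its ONE row `hlift` DISCHARGED by §2 (a minimiser over `regFibrePr ε₀ V` is
R2-critical, lit ✓`isCritR2_of_isMinOn`): for every profile `b₀, p₀ > 0` there is `e₉ > 0` such that at every member, heights `J < K`, `0 < ε₀ ≤ e₉`, EVERY datum `V` and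
every `U₀ ∈ regFibrePr ε₀ V` with `A(U₀) = minActionRegPr ε₀ V`: `∃ γs > 0`, for `0 < γ ≤ γs` with `U₀` a good history, `∃ μ > 0` with the GAP♭ inequality
`μ·L^{−2(K−J)}·⨅_{w residual} Σ_ℓ dist1(U ℓ·((w • U₀) ℓ)⁻¹)² ≤ A(U) − minActionRegPr ε₀ V` for every good history `U` of the fibre (FILE 1's `γs`, `μ` verbatim).
[cite: Balaban1985Variational, (142) p.299, Prop. 7 p.299, Thm 1 (8) p.279; Balaban1984PropagatorsI, Prop. 1.2 (1.110)-(1.111) p.35; Balaban1985RegularSpaces, Thm 2 p.83] -/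
theorem gapFlat_at_min_five (L : ℕ) (h5 : 5 ≤ L) (b₀ p₀ : ℝ) (hb : 0 < b₀) (hp : 0 < p₀) :
    ∃ e₉ : ℝ, 0 < e₉ ∧
      ∀ (F : T3Family), F.L = L → ∀ (J K : ℕ) (hJK : J < K) (ε₀ : ℝ)
        (V : GaugeField (F.P J) 0 (Matrix.specialUnitaryGroup (Fin 2) ℂ)) (U₀ : GaugeField (F.P K) 0 (Matrix.specialUnitaryGroup (Fin 2) ℂ)),
        0 < ε₀ → ε₀ ≤ e₉ → U₀ ∈ regFibrePr F J K hJK.le ε₀ V →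
        wilsonAction4 U₀ = minActionRegPr F J K hJK.le ε₀ V →
        ∃ γs : ℝ, 0 < γs ∧ ∀ (γ : ℝ), 0 < γ → γ ≤ γs → U₀ ∈ histGood F ℰp (θBal F.L γ b₀ p₀) K J →
        ∃ μ : ℝ, 0 < μ ∧ ∀ U ∈ fibre F ℰp J K hJK.le V, U ∈ histGood F ℰp (θBal F.L γ b₀ p₀) K J →
          μ * ((F.L : ℝ)⁻¹) ^ (2 * (K - J)) *
              (⨅ w : {w : Site (F.P K) 0 → Matrix.specialUnitaryGroup (Fin 2) ℂ |
                  ∀ U : GaugeField (F.P K) 0 (Matrix.specialUnitaryGroup (Fin 2) ℂ),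
                    descendTo F ℰp J K hJK.le (GaugeField.gaugeAct w U) = descendTo F ℰp J K hJK.le U},
                ∑ ℓ : PBond (F.P K) 0,
                  dist1 (U ℓ * ((GaugeField.gaugeAct (w : Site (F.P K) 0 → Matrix.specialUnitaryGroup (Fin 2) ℂ) U₀) ℓ)⁻¹) ^ 2)
            ≤ wilsonAction4 U - minActionRegPr F J K hJK.le ε₀ V := by
  obtain ⟨e₉, he₉, H⟩ := gapFlat_at_min_of_lift_five L h5 b₀ p₀ hb hp
  obtain ⟨e₈, he₈, HL⟩ := symmetriesLift_of_isCritR2_five L h5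
  refine ⟨min e₉ e₈, lt_min he₉ he₈, ?_⟩
  intro F hF J K hJK ε₀ V U₀ hε₀ hεe hU₀ hmin
  have hcrit : IsCritR2 F J K hJK.le V U₀ :=
    isCritR2_of_isMinOn hε₀ hU₀ (isMinOn_iff.mpr fun W hW => hmin.trans_le (minActionRegPr_le F hW))
  exact H F hF J K hJK ε₀ V U₀ hε₀ (hεe.trans (min_le_left _ _)) hU₀ hmin
    (HL F hF J K hJK ε₀ V U₀ hε₀ (hεe.trans (min_le_right _ _)) hU₀ hcrit)

/-! ## §5 ★★★★★ THE PRINTED LETTERS DISCHARGED AT EVERY `L ≥ 5`: [Balaban1985Variational] PROP. 7 CLAUSE 1 and THM 1 SENTENCE 2 as the Literature schemas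
`T3Thm1UniquenessSchema.Prop7AtMostOneCriticalOrbitAt` ∕ `Thm1UniqueMinOrbitAt` (✓p777836) — hitherto HYPOTHESES of the (α)-inputs and GAP♯∘ lanes -/

/-- ★★★★★ **[Balaban1985Variational] PROP. 7 CLAUSE 1 AS TYPED IN THE LITERATURE SCHEMA, PROVED AT EVERY `L ≥ 5`**: «There exist positive, absolute constants a₀ … such that for
ε₀ ≤ a₀ and B₃ε₁ ≤ ε₀ the variational problem (5), (6) has at most one critical orbit» — for every `B₃ > 0` there is `a₀ > 0` with `Prop7AtMostOneCriticalOrbitAt L a₀ B₃`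
(§3; the datum's smallness (7) is not even used). [cite: Balaban1985Variational, Prop. 7 p.299] -/
theorem prop7AtMostOneCriticalOrbitAt_five (L : ℕ) (h5 : 5 ≤ L) (B₃ : ℝ) (hB₃ : 0 < B₃) :
    ∃ a₀ : ℝ, 0 < a₀ ∧ Prop7AtMostOneCriticalOrbitAt L a₀ B₃ := by
  obtain ⟨e₉, he₉, H⟩ := atMostOneCriticalOrbit_five L h5
  refine ⟨e₉, he₉, fun F hF n K hnK ε₁ ε₀ hε₁ hlo hhi V _ => H F hF n K hnK ε₀ V ((mul_pos hB₃ hε₁).trans_le hlo) hhi⟩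

/-- ★★★★★ **[Balaban1985Variational] THM 1, SECOND SENTENCE («This orbit is a unique critical orbit in the space (6) if B₃ε₁ ≤ ε₀ and ε₀ ≤ a₀»), MINIMISER READING, AS TYPED
IN THE LITERATURE SCHEMA, PROVED AT EVERY `L ≥ 5`**: for every `B₃ > 0` and every `a₁` there is `a₀ > 0` with `Thm1UniqueMinOrbitAt L a₀ a₁ B₃` (Prop. 7 clause 1 ⟹ Thm 1
sentence 2, ✓`thm1UniqueMinOrbitAt_of_prop7`; print p.299 «This proposition implies Theorem 1 but with worse bounds»). [cite: Balaban1985Variational, Thm 1 (8) p.279, Prop. 7 p.299] -/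
theorem thm1UniqueMinOrbitAt_five (L : ℕ) (h5 : 5 ≤ L) (B₃ : ℝ) (hB₃ : 0 < B₃) (a₁ : ℝ) :
    ∃ a₀ : ℝ, 0 < a₀ ∧ Thm1UniqueMinOrbitAt L a₀ a₁ B₃ := by
  obtain ⟨a₀, ha₀, h7⟩ := prop7AtMostOneCriticalOrbitAt_five L h5 B₃ hB₃
  exact ⟨a₀, ha₀, thm1UniqueMinOrbitAt_of_prop7 hB₃ h7 a₁⟩

/-! ## §6 ★★★★★ [Balaban1985Variational] THEOREM 1 — BOTH SENTENCES (existence (8), global reading R2 ∧ uniqueness of the minimal orbit in (6)) AT ONE SET OF CONSTANTS, EVERY `L ≥ 5`, ZERO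
HYPOTHESES; and the all-`L` pair from its `L = 3` instance alone (the shape of ✓`argmin_eq_orbit_of_thm1Pair_of_regArgmin`'s `hT`) -/

/-- ★★★★★ **[Balaban1985Variational] THEOREM 1, BOTH SENTENCES, AT EVERY BLOCK SIZE `L ≥ 5` — ZERO HYPOTHESES**: constants `a₀, a₁, B₃ > 0` («depend on d and L only») with
`Thm1GlobalMinAt L a₀ a₁ B₃` (sentence 1, (8), global reading — ✓`Thm1GuardedFiveResidueThree.thm1GlobalMinAt_five`: the halving ✓`stub_halvingStep` + the existence clause
✓`exBody_guarded_five`) AND `Thm1UniqueMinOrbitAt L a₀ a₁ B₃` (sentence 2 — §5, at the same `a₁, B₃`; both schemas are antitone in `a₀`, so `a₀ := min`).  This is the `hT`-pair of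
✓`…ArgminOrbitOfUniqueCriticalOrbit.exists_uniqueCriticalOrbit_of_thm1Pair` ∕ `argmin_eq_orbit_of_thm1Pair_of_regArgmin` at every `L ≥ 5`.
[cite: Balaban1985Variational, Thm 1 (8) p.279, Prop. 7 p.299, Prop. 8 p.304; Balaban1985RegularSpaces, Thm 2 p.83] -/
theorem thm1Pair_five (L : ℕ) (h5 : 5 ≤ L) :
    ∃ a₀ a₁ B₃ : ℝ, 0 < a₀ ∧ 0 < a₁ ∧ 0 < B₃ ∧ Thm1GlobalMinAt L a₀ a₁ B₃ ∧ Thm1UniqueMinOrbitAt L a₀ a₁ B₃ := by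
  obtain ⟨a₀, a₁, B₃, ha₀, ha₁, hB₃, hT⟩ := thm1GlobalMinAt_five L h5
  obtain ⟨a₀', ha₀', hU⟩ := thm1UniqueMinOrbitAt_five L h5 B₃ hB₃ a₁
  refine ⟨min a₀ a₀', a₁, B₃, lt_min ha₀ ha₀', ha₁, hB₃, ?_, thm1UniqueMinOrbitAt_mono hU (min_le_right _ _) le_rfl⟩
  intro F hF n K hnK ε₁ ε₀ hε₁ hε₁a hlo hhi V hV
  exact hT F hF n K hnK ε₁ ε₀ hε₁ hε₁a hlo (hhi.trans (min_le_left _ _)) V hV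

/-- **THE THM-1 PAIR FOR ALL `L > 1` ⟸ ITS `L = 3` INSTANCE ALONE** (the `hT` of ✓`argmin_eq_orbit_of_thm1Pair_of_regArgmin` VERBATIM): `L = 3` from the hypothesis (the [Balaban1985RegularSpaces]
Thm-2 socket at `L = 3`, EMBARGO-LITE №58), `L ≥ 5` by `thm1Pair_five`, `L` even or `≤ 1` excluded by `Odd L ∧ 1 < L`. [cite: Balaban1985Variational, Thm 1 p.279; Balaban1987RG1, §0 p.251] -/
theorem thm1Pair_allL_of_three
    (h3 : ∃ a₀ a₁ B₃ : ℝ, 0 < a₀ ∧ 0 < a₁ ∧ 0 < B₃ ∧ Thm1GlobalMinAt 3 a₀ a₁ B₃ ∧ Thm1UniqueMinOrbitAt 3 a₀ a₁ B₃) :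
    ∀ L : ℕ, Odd L → 1 < L → ∃ a₀ a₁ B₃ : ℝ, 0 < a₀ ∧ 0 < a₁ ∧ 0 < B₃ ∧ Thm1GlobalMinAt L a₀ a₁ B₃ ∧ Thm1UniqueMinOrbitAt L a₀ a₁ B₃ := by
  intro L hLo hL
  by_cases hL3 : L = 3
  · subst hL3; exact h3
  · exact thm1Pair_five L (five_le_of_odd_of_ne_three hLo hL hL3)

end Summit.QuantumFields.YangMills.Theorems.FluctuationComparisonRegPrIntLS2BetaSymmetriesLiftOfCritical

end
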